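import Literature.AnabelianGeometry.SemiGraphs.TemperedCompactPairUnfoldedCrossing
import Literature.AnabelianGeometry.SemiGraphs.SubdivisionPathTurns
import HarnessLib

/-!
# Two compact subgroups of `π₁^temp(𝒢)` at tree distance EXACTLY TWO at every level: the two-step configuration
# `x_M – z_M – y_M` is UNIQUE and COMPATIBLE, hence the pair is ANCHORED

Mochizuki, *Semi-graphs of anabelioids*, Publ. RIMS **42** (2006), §1, Lemma 1.8 (ii) p. 20, §3, Theorem 3.7
(iv) p. 41: "The maximal compact subgroups of `π₁^temp(𝒢)` are precisely the verticial subgroups. The nontrivial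
intersections of two distinct maximal compact subgroups of `π₁^temp(𝒢)` are precisely the edge-like subgroups."
[cite: MochizukiSemiAnbd2006, Thm 3.7(iv) p.41].

PROOF-ONLY tool file (abc-iut cell, layer L3, row «T37iv-S2@SPARSE-CLASS», file F9a, seat abc-iut-L3-t8 gen 11;
no definition, no named fact).  Canonical chart of ANY countable `𝒢` with the hypotheses of Prop. 3.6, ANY
subgroups `K₁`, `K₂` (no compactness, no estrangement).  A *two-step configuration* of `𝒢_{∞,M}` is a vertex
`z` fixed by neither subgroup joined by an edge (branches `β₁ ≠ β₁'`) to a `K₁`-fixed vertex `x` and by an edge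
(branches `β₂ ≠ β₂'`) to a `K₂`-fixed vertex `y` — the distance-two analogue of the BRIDGE of
`TemperedCompactPairDistanceOne.lean` (F2), whose (I2)/(I3) conclusion it reproduces:

* `SemiGraph.exists_twoStep_path` — the path `x – β₁ – ε₁ – β₁' – z – β₂ – ε₂ – β₂' – y` and its support;
  `SemiGraph.edge_unique` — adjacent vertices of a tree are joined by ONE edge (with its two branches);
* `twoStep_middle_unique` — at a level without common fixed vertex all two-step configurations share the middle
  vertex (the walk `x' ⟶ x – z – y ⟶ y'`, outer legs fixed node-wise, passes `z'` — abc-iut-f-172's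
  `SemiGraph.mem_support_of_mem_support_path`); `fixed_neighbour_unique` — a vertex not fixed by `K` has at most
  ONE `K`-fixed neighbour, along ONE edge;
* ★ `anchored_of_forall_exists_twoStep` — if no level `M ≥ m` carries a bridge and every level carries a two-step
  configuration, the configurations DESCEND (the image of a deeper one is again one: its middle vertex is fixed by
  neither subgroup for want of a bridge), hence are COMPATIBLE by uniqueness: `K₁`, `K₂` lie in VERTICIAL
  subgroups ((I2), F2's `exists_verticial_ge_of_eventually_compatible_fixed`) and `K₁ ⊓ K₂`, fixing the path
  `x_M – z_M – y_M` node-wise, lies in an EDGE-LIKE subgroup of the compatible edges `x_M – z_M` ((I3)).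

Sequel: `TemperedCompactPairSparse.lean` (F9b) — at SPARSE graphs the third regime of the trichotomy IS the
two-step regime (F8), so it is anchored.  Honest framing: generic statements about OUR typed `π₁^temp`; nothing
here bears on [IUTchIII] Cor. 3.12; no side taken; typed ≠ proved.
-/
noncomputable section

open CategoryTheory Topology

namespace Literature.AnabelianGeometry.SemiGraphs

open SimpleGraph

universe u

namespace SemiGraph

variable {T : SemiGraph.{u}}

/-- **The two-step path** `x – β₁ – ε₁ – β₁' – z – β₂ – ε₂ – β₂' – y` of the barycentric subdivision (distinct
vertices `x`, `z`, `y`; `β₁ ≠ β₁'` the branches of `ε₁`, `β₂ ≠ β₂'` those of `ε₂`) is a path; its support.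
[cite: MochizukiSemiAnbd2006, §1 pp.11-12] -/
theorem exists_twoStep_path {x z y : T.Vertex} {β₁ β₁' β₂ β₂' : T.Branch} (h11 : β₁ ≠ β₁')
    (he₁ : T.edgeOf β₁ = T.edgeOf β₁') (hβ₁ : T.abuts β₁ = some x) (hβ₁' : T.abuts β₁' = some z) (h22 : β₂ ≠ β₂')
    (he₂ : T.edgeOf β₂ = T.edgeOf β₂') (hβ₂ : T.abuts β₂ = some z) (hβ₂' : T.abuts β₂' = some y) (hxz : x ≠ z)
    (hzy : z ≠ y) (hxy : x ≠ y) :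
    ∃ P : T.subdivision.Walk (Sum.inl x) (Sum.inl y), P.IsPath ∧
      P.support = [Sum.inl x, Sum.inr (Sum.inr β₁), Sum.inr (Sum.inl (T.edgeOf β₁)), Sum.inr (Sum.inr β₁'),
        Sum.inl z, Sum.inr (Sum.inr β₂), Sum.inr (Sum.inl (T.edgeOf β₂)), Sum.inr (Sum.inr β₂'), Sum.inl y] := by
  obtain ⟨w₁, hw₁⟩ := exists_walk_along_edge he₁ hβ₁ hβ₁'
  obtain ⟨w₂, hw₂⟩ := exists_walk_along_edge he₂ hβ₂ hβ₂'
  -- the two edges are distinct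
  have hee : T.edgeOf β₁ ≠ T.edgeOf β₂ := by
    intro hee
    rcases eq_or_eq_of_edgeOf_eq h11 he₁ hee.symm with h | h
    · exact hxz (Option.some.inj (hβ₁.symm.trans (h ▸ hβ₂)))
    · -- `β₂ = β₁'`, so `β₂'` is the other branch `β₁` of `ε₁`, abutting to `x = y`
      rcases eq_or_eq_of_edgeOf_eq h11 he₁ (he₂.symm.trans hee.symm) with h' | h'
      · exact hxy (Option.some.inj (hβ₁.symm.trans (h' ▸ hβ₂')))
      · exact h22 (h.trans h'.symm)
  have h12 : β₁ ≠ β₂ := fun h => hee (by rw [h])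
  have h12' : β₁ ≠ β₂' := fun h => hee (by rw [h, he₂])
  have h1'2 : β₁' ≠ β₂ := fun h => hee (by rw [he₁, h])
  have h1'2' : β₁' ≠ β₂' := fun h => hee (by rw [he₁, h, he₂])
  refine ⟨w₁.append w₂, ?_, ?_⟩
  · rw [Walk.isPath_def, Walk.support_append, hw₁, hw₂]
    simp [hxz, hzy, hxy, h11, h22, hee, h12, h12', h1'2, h1'2']
  · rw [Walk.support_append, hw₁, hw₂]
    simp

/-- **Adjacent vertices of a tree are joined by ONE edge**: if `β₁ ≠ β₁'` (of `ε₁`) and `γ₁ ≠ γ₁'` (of `ε`)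
both join `x` to `z ≠ x`, then `β₁ = γ₁` and `β₁' = γ₁'` (the two length-four paths coincide).
[cite: MochizukiSemiAnbd2006, §1 p.13] -/
theorem edge_unique (hT : T.subdivision.IsAcyclic) {x z : T.Vertex} {β₁ β₁' γ₁ γ₁' : T.Branch} (h11 : β₁ ≠ β₁')
    (he₁ : T.edgeOf β₁ = T.edgeOf β₁') (hβ₁ : T.abuts β₁ = some x) (hβ₁' : T.abuts β₁' = some z) (g11 : γ₁ ≠ γ₁')
    (hg₁ : T.edgeOf γ₁ = T.edgeOf γ₁') (hγ₁ : T.abuts γ₁ = some x) (hγ₁' : T.abuts γ₁' = some z) (hxz : x ≠ z) :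
    β₁ = γ₁ ∧ β₁' = γ₁' := by
  obtain ⟨w, hw⟩ := exists_walk_along_edge he₁ hβ₁ hβ₁'
  obtain ⟨w', hw'⟩ := exists_walk_along_edge hg₁ hγ₁ hγ₁'
  have hwp : w.IsPath := by rw [Walk.isPath_def, hw]; simp [hxz, h11]
  have hw'p : w'.IsPath := by rw [Walk.isPath_def, hw']; simp [hxz, g11]
  have heq : w = w' := congrArg Subtype.val (hT.path_unique ⟨w, hwp⟩ ⟨w', hw'p⟩)
  have hs : w.support = w'.support := by rw [heq]
  rw [hw, hw'] at hs
  simp only [List.cons.injEq, Sum.inr.injEq, and_true, true_and] at hs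
  exact ⟨hs.1, hs.2.2⟩

end SemiGraph

namespace ProfiniteSemiGraph

variable {𝒢 : ProfiniteSemiGraph.{u}}

/-! ### Uniqueness of the two-step configuration at a level without common fixed vertex -/

section TwoStep

variable (h36 : 𝒢.Prop36Hypotheses) (K₁ K₂ : Subgroup ((𝒢.galoisLevelData h36).temperedPi h36.isCountable))
  (M : ℕ)
  (hno : ∀ z : ((𝒢.galoisLevelData h36).tree M).Vertex,
    (∀ k ∈ K₁, ((𝒢.galoisLevelData h36).treeAct h36.isCountable M k).hom.vertexMap z = z) →
      ¬ ∀ k ∈ K₂, ((𝒢.galoisLevelData h36).treeAct h36.isCountable M k).hom.vertexMap z = z)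

include hno

/-- **The middle vertex is unique.**  If `x – z – y` and `x' – z' – y'` are two-step configurations of `𝒢_{∞,M}`
(`x`, `x'` fixed by `K₁`; `y`, `y'` by `K₂`; `z`, `z'` by neither) and `K₁`, `K₂` fix no common vertex, then
`z = z'`: the walk `x' ⟶ x – z – y ⟶ y'` (the outer legs fixed node-wise by `K₁`, resp. `K₂`) passes `z'`.
[cite: MochizukiSemiAnbd2006, Lem. 1.8(ii) p.20] -/
theorem twoStep_middle_unique {x z y x' z' y' : ((𝒢.galoisLevelData h36).tree M).Vertex}
    {β₁ β₁' β₂ β₂' γ₁ γ₁' γ₂ γ₂' : ((𝒢.galoisLevelData h36).tree M).Branch}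
    (h11 : β₁ ≠ β₁') (he₁ : ((𝒢.galoisLevelData h36).tree M).edgeOf β₁ = ((𝒢.galoisLevelData h36).tree M).edgeOf β₁')
    (hβ₁ : ((𝒢.galoisLevelData h36).tree M).abuts β₁ = some x)
    (hβ₁' : ((𝒢.galoisLevelData h36).tree M).abuts β₁' = some z) (h22 : β₂ ≠ β₂')
    (he₂ : ((𝒢.galoisLevelData h36).tree M).edgeOf β₂ = ((𝒢.galoisLevelData h36).tree M).edgeOf β₂')
    (hβ₂ : ((𝒢.galoisLevelData h36).tree M).abuts β₂ = some z)
    (hβ₂' : ((𝒢.galoisLevelData h36).tree M).abuts β₂' = some y)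
    (g11 : γ₁ ≠ γ₁') (hg₁ : ((𝒢.galoisLevelData h36).tree M).edgeOf γ₁ = ((𝒢.galoisLevelData h36).tree M).edgeOf γ₁')
    (hγ₁ : ((𝒢.galoisLevelData h36).tree M).abuts γ₁ = some x')
    (hγ₁' : ((𝒢.galoisLevelData h36).tree M).abuts γ₁' = some z') (g22 : γ₂ ≠ γ₂')
    (hg₂ : ((𝒢.galoisLevelData h36).tree M).edgeOf γ₂ = ((𝒢.galoisLevelData h36).tree M).edgeOf γ₂')
    (hγ₂ : ((𝒢.galoisLevelData h36).tree M).abuts γ₂ = some z')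
    (hγ₂' : ((𝒢.galoisLevelData h36).tree M).abuts γ₂' = some y')
    (hx : ∀ k ∈ K₁, ((𝒢.galoisLevelData h36).treeAct h36.isCountable M k).hom.vertexMap x = x)
    (hy : ∀ k ∈ K₂, ((𝒢.galoisLevelData h36).treeAct h36.isCountable M k).hom.vertexMap y = y)
    (hz₁ : ¬ ∀ k ∈ K₁, ((𝒢.galoisLevelData h36).treeAct h36.isCountable M k).hom.vertexMap z = z)
    (hz₂ : ¬ ∀ k ∈ K₂, ((𝒢.galoisLevelData h36).treeAct h36.isCountable M k).hom.vertexMap z = z)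
    (hx' : ∀ k ∈ K₁, ((𝒢.galoisLevelData h36).treeAct h36.isCountable M k).hom.vertexMap x' = x')
    (hy' : ∀ k ∈ K₂, ((𝒢.galoisLevelData h36).treeAct h36.isCountable M k).hom.vertexMap y' = y')
    (hz'₁ : ¬ ∀ k ∈ K₁, ((𝒢.galoisLevelData h36).treeAct h36.isCountable M k).hom.vertexMap z' = z')
    (hz'₂ : ¬ ∀ k ∈ K₂, ((𝒢.galoisLevelData h36).treeAct h36.isCountable M k).hom.vertexMap z' = z') :
    z = z' := by
  classical
  let Dg := 𝒢.galoisLevelData h36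
  have hc := h36.isCountable
  let T := Dg.tree M
  have hT := (Dg.isTree_tree M).isTree
  have hxz : x ≠ z := fun h => hz₁ (h ▸ hx)
  have hzy : z ≠ y := fun h => hz₂ (h ▸ hy)
  have hxy : x ≠ y := fun h => hno x hx (h ▸ hy)
  have hxz' : x' ≠ z' := fun h => hz'₁ (h ▸ hx')
  have hzy' : z' ≠ y' := fun h => hz'₂ (h ▸ hy')
  have hxy' : x' ≠ y' := fun h => hno x' hx' (h ▸ hy')
  obtain ⟨P, hP, hPs⟩ := SemiGraph.exists_twoStep_path h11 he₁ hβ₁ hβ₁' h22 he₂ hβ₂ hβ₂' hxz hzy hxy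
  obtain ⟨P', hP', hP's⟩ := SemiGraph.exists_twoStep_path g11 hg₁ hγ₁ hγ₁' g22 hg₂ hγ₂ hγ₂' hxz' hzy' hxy'
  obtain ⟨r₁, hr₁, -⟩ := (hT.connected (Sum.inl x' : T.Node) (Sum.inl x)).exists_path_of_dist
  obtain ⟨r₂, hr₂, -⟩ := (hT.connected (Sum.inl y : T.Node) (Sum.inl y')).exists_path_of_dist
  have hz'P' : (Sum.inl z' : T.Node) ∈ P'.support := by rw [hP's]; simp
  have hmem : (Sum.inl z' : T.Node) ∈ (r₁.append (P.append r₂)).support :=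
    SemiGraph.mem_support_of_mem_support_path hT.isAcyclic P' hP' hz'P' _
  rw [Walk.mem_support_append_iff, Walk.mem_support_append_iff] at hmem
  rcases hmem with h | h | h
  · exact absurd (fun k hk => (fixes_of_mem_support_path h36 M k (hx' k hk) (hx k hk) r₁ hr₁).1 z' h) hz'₁
  · rw [hPs] at h
    simp only [List.mem_cons, Sum.inl.injEq, reduceCtorEq, List.not_mem_nil, or_false, false_or] at h
    rcases h with h | h | h
    · exact absurd (h ▸ hx) hz'₁
    · exact h.symm
    · exact absurd (h ▸ hy) hz'₂
  · exact absurd (fun k hk => (fixes_of_mem_support_path h36 M k (hy k hk) (hy' k hk) r₂ hr₂).1 z' h) hz'₂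

omit hno in
/-- **A vertex not fixed by `K` has at most one `K`-fixed neighbour** (the path `x – z – x'` between two
`K`-fixed vertices would be fixed node-wise); and the joining edge is unique (`SemiGraph.edge_unique`).
[cite: MochizukiSemiAnbd2006, Lem. 1.8(ii)(b) p.20] -/
theorem fixed_neighbour_unique (K : Subgroup ((𝒢.galoisLevelData h36).temperedPi h36.isCountable))
    {x z x' : ((𝒢.galoisLevelData h36).tree M).Vertex} {β₁ β₁' γ₁ γ₁' : ((𝒢.galoisLevelData h36).tree M).Branch}
    (h11 : β₁ ≠ β₁') (he₁ : ((𝒢.galoisLevelData h36).tree M).edgeOf β₁ = ((𝒢.galoisLevelData h36).tree M).edgeOf β₁')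
    (hβ₁ : ((𝒢.galoisLevelData h36).tree M).abuts β₁ = some x)
    (hβ₁' : ((𝒢.galoisLevelData h36).tree M).abuts β₁' = some z)
    (g11 : γ₁ ≠ γ₁') (hg₁ : ((𝒢.galoisLevelData h36).tree M).edgeOf γ₁ = ((𝒢.galoisLevelData h36).tree M).edgeOf γ₁')
    (hγ₁ : ((𝒢.galoisLevelData h36).tree M).abuts γ₁ = some x')
    (hγ₁' : ((𝒢.galoisLevelData h36).tree M).abuts γ₁' = some z)
    (hx : ∀ k ∈ K, ((𝒢.galoisLevelData h36).treeAct h36.isCountable M k).hom.vertexMap x = x)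
    (hx' : ∀ k ∈ K, ((𝒢.galoisLevelData h36).treeAct h36.isCountable M k).hom.vertexMap x' = x')
    (hz : ¬ ∀ k ∈ K, ((𝒢.galoisLevelData h36).treeAct h36.isCountable M k).hom.vertexMap z = z) :
    x = x' ∧ β₁ = γ₁ ∧ β₁' = γ₁' := by
  classical
  let Dg := 𝒢.galoisLevelData h36
  have hc := h36.isCountable
  let T := Dg.tree M
  have hT := (Dg.isTree_tree M).isTree
  have hxz : x ≠ z := fun h => hz (h ▸ hx)
  have hx'z : x' ≠ z := fun h => hz (h ▸ hx')
  have hxx' : x = x' := by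
    by_contra hxx'
    -- the path `x – z – x'` is fixed node-wise by `K`, so `z` would be fixed
    obtain ⟨b₂, b₂', -, -, -, -⟩ := (⟨γ₁', γ₁, g11.symm, hg₁.symm, hγ₁', hγ₁⟩ :
      ∃ b₂ b₂' : T.Branch, b₂ ≠ b₂' ∧ T.edgeOf b₂ = T.edgeOf b₂' ∧ T.abuts b₂ = some z ∧ T.abuts b₂' = some x')
    obtain ⟨P, hP, hPs⟩ := SemiGraph.exists_twoStep_path h11 he₁ hβ₁ hβ₁' g11.symm hg₁.symm hγ₁' hγ₁ hxz
      hx'z.symm hxx'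
    have hzP : (Sum.inl z : T.Node) ∈ P.support := by rw [hPs]; simp
    exact hz fun k hk => (fixes_of_mem_support_path h36 M k (hx k hk) (hx' k hk) P hP).1 z hzP
  subst hxx'
  exact ⟨rfl, SemiGraph.edge_unique hT.isAcyclic h11 he₁ hβ₁ hβ₁' g11 hg₁ hγ₁ hγ₁' hxz⟩

end TwoStep

/-! ### ★ Two-step configurations at every level are compatible: the anchored regime -/

section Anchored

variable (h36 : 𝒢.Prop36Hypotheses) (K₁ K₂ : Subgroup ((𝒢.galoisLevelData h36).temperedPi h36.isCountable))
  (m : ℕ)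
  (hno : ∀ z : ((𝒢.galoisLevelData h36).tree m).Vertex,
    (∀ k ∈ K₁, ((𝒢.galoisLevelData h36).treeAct h36.isCountable m k).hom.vertexMap z = z) →
      ¬ ∀ k ∈ K₂, ((𝒢.galoisLevelData h36).treeAct h36.isCountable m k).hom.vertexMap z = z)
  (hnobr : ∀ (M : ℕ), m ≤ M → ¬ ∃ (x y : ((𝒢.galoisLevelData h36).tree M).Vertex)
      (β₁ β₂ : ((𝒢.galoisLevelData h36).tree M).Branch),
    β₁ ≠ β₂ ∧ ((𝒢.galoisLevelData h36).tree M).edgeOf β₁ = ((𝒢.galoisLevelData h36).tree M).edgeOf β₂ ∧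
    ((𝒢.galoisLevelData h36).tree M).abuts β₁ = some x ∧ ((𝒢.galoisLevelData h36).tree M).abuts β₂ = some y ∧
    (∀ k ∈ K₁, ((𝒢.galoisLevelData h36).treeAct h36.isCountable M k).hom.vertexMap x = x) ∧
    ∀ k ∈ K₂, ((𝒢.galoisLevelData h36).treeAct h36.isCountable M k).hom.vertexMap y = y)
  (htwo : ∀ (M : ℕ), m ≤ M → ∃ (x z y : ((𝒢.galoisLevelData h36).tree M).Vertex)
      (β₁ β₁' β₂ β₂' : ((𝒢.galoisLevelData h36).tree M).Branch),
    β₁ ≠ β₁' ∧ ((𝒢.galoisLevelData h36).tree M).edgeOf β₁ = ((𝒢.galoisLevelData h36).tree M).edgeOf β₁' ∧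
    ((𝒢.galoisLevelData h36).tree M).abuts β₁ = some x ∧ ((𝒢.galoisLevelData h36).tree M).abuts β₁' = some z ∧
    β₂ ≠ β₂' ∧ ((𝒢.galoisLevelData h36).tree M).edgeOf β₂ = ((𝒢.galoisLevelData h36).tree M).edgeOf β₂' ∧
    ((𝒢.galoisLevelData h36).tree M).abuts β₂ = some z ∧ ((𝒢.galoisLevelData h36).tree M).abuts β₂' = some y ∧
    (∀ k ∈ K₁, ((𝒢.galoisLevelData h36).treeAct h36.isCountable M k).hom.vertexMap x = x) ∧
    (∀ k ∈ K₂, ((𝒢.galoisLevelData h36).treeAct h36.isCountable M k).hom.vertexMap y = y) ∧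
    (¬ ∀ k ∈ K₁, ((𝒢.galoisLevelData h36).treeAct h36.isCountable M k).hom.vertexMap z = z) ∧
    ¬ ∀ k ∈ K₂, ((𝒢.galoisLevelData h36).treeAct h36.isCountable M k).hom.vertexMap z = z)

include hno hnobr htwo

/-- ★ **Two-step configurations at every level are ANCHORED.**  If `K₁` and `K₂` fix no common vertex of
`𝒢_{∞,m}`, no level `M ≥ m` carries a bridge, and every level `M ≥ m` carries a two-step configuration
`x_M – z_M – y_M` (`x_M` fixed by `K₁`, `y_M` by `K₂`, `z_M` by neither), then the image in `𝒢_{∞,M}` of the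
configuration of a deeper level is again such a configuration (its middle vertex fixed by neither subgroup for
want of a bridge), hence IS the configuration of level `M` (uniqueness): the `x_M`, `y_M` form COMPATIBLE systems
fixed by `K₁`, resp. `K₂` — so `K₁`, `K₂` lie in VERTICIAL subgroups by (I2) — and the edges `x_M – z_M`, fixed with
their branches by every element of `K₁ ⊓ K₂` (which fixes the path `x_M – z_M – y_M` node-wise), form a compatible
system — so `K₁ ⊓ K₂` lies in an EDGE-LIKE subgroup by (I3). [cite: MochizukiSemiAnbd2006, Thm 3.7(iv) p.41] -/
theorem anchored_of_forall_exists_twoStep :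
    (∃ (v : 𝒢.graph.Vertex) (H : Subgroup (𝒢.temperedPiChart h36).G),
        H ∈ verticialSubgroups (𝒢.temperedPiChart h36) v ∧ K₁ ≤ H) ∧
    (∃ (v : 𝒢.graph.Vertex) (H : Subgroup (𝒢.temperedPiChart h36).G),
        H ∈ verticialSubgroups (𝒢.temperedPiChart h36) v ∧ K₂ ≤ H) ∧
    ∃ (e : 𝒢.graph.Edge) (L : Subgroup (𝒢.temperedPiChart h36).G),
      L ∈ edgeLikeSubgroups (𝒢.temperedPiChart h36) e ∧ K₁ ⊓ K₂ ≤ L := by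
  classical
  let Dg := 𝒢.galoisLevelData h36
  have hc := h36.isCountable
  let D₀ : VerticialLevelData.{0} 𝒢 (𝒢.temperedPiChart h36) := verticialLevelData_temperedPiChart (h36 := h36)
  choose x z y β₁ β₁' β₂ β₂' h11 he₁ hβ₁ hβ₁' h22 he₂ hβ₂ hβ₂' hx hy hz₁ hz₂ using htwo
  -- pushing fixedness down along the transitions
  have hpushV : ∀ (K : Subgroup (Dg.temperedPi hc)) {M M' : ℕ} (h : M ≤ M') (w : (Dg.tree M').Vertex),
      (∀ k ∈ K, (Dg.treeAct hc M' k).hom.vertexMap w = w) →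
      ∀ k ∈ K, (Dg.treeAct hc M k).hom.vertexMap ((Dg.treeTrans h).vertexMap w) = (Dg.treeTrans h).vertexMap w := by
    intro K M M' h w hw k hk
    have e : (Dg.treeTrans h).vertexMap ((Dg.treeAct hc M' k).hom.vertexMap w) =
        (Dg.treeAct hc M k).hom.vertexMap ((Dg.treeTrans h).vertexMap w) := D₀.trans_act_vertexMap h k w
    rw [hw k hk] at e
    exact e.symm
  -- the image of the configuration of level `M'` in level `M` is a configuration of level `M`
  have hdesc : ∀ {M M' : ℕ} (hM : m ≤ M) (hMM' : M ≤ M'),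
      (Dg.treeTrans hMM').vertexMap (z M' (hM.trans hMM')) = z M hM ∧
      (Dg.treeTrans hMM').vertexMap (x M' (hM.trans hMM')) = x M hM ∧
      (Dg.treeTrans hMM').branchMap (β₁ M' (hM.trans hMM')) = β₁ M hM ∧
      (Dg.treeTrans hMM').branchMap (β₁' M' (hM.trans hMM')) = β₁' M hM ∧
      (Dg.treeTrans hMM').vertexMap (y M' (hM.trans hMM')) = y M hM := by
    intro M M' hM hMM'
    have hM' : m ≤ M' := hM.trans hMM'
    let π := Dg.treeTrans hMM'
    have hnoM : ∀ w : (Dg.tree M).Vertex, (∀ k ∈ K₁, (Dg.treeAct hc M k).hom.vertexMap w = w) →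
        ¬ ∀ k ∈ K₂, (Dg.treeAct hc M k).hom.vertexMap w = w :=
      fun w hw => forall_not_common_fixed_of_le h36 K₁ K₂ hM hno w hw
    -- the pushed-down data
    have gx : ∀ k ∈ K₁, (Dg.treeAct hc M k).hom.vertexMap (π.vertexMap (x M' hM')) = π.vertexMap (x M' hM') :=
      hpushV K₁ hMM' _ (hx M' hM')
    have gy : ∀ k ∈ K₂, (Dg.treeAct hc M k).hom.vertexMap (π.vertexMap (y M' hM')) = π.vertexMap (y M' hM') :=
      hpushV K₂ hMM' _ (hy M' hM')
    have g11 : π.branchMap (β₁ M' hM') ≠ π.branchMap (β₁' M' hM') :=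
      fun h => h11 M' hM' (π.branchMap_injOn _ _ (he₁ M' hM') h)
    have g22 : π.branchMap (β₂ M' hM') ≠ π.branchMap (β₂' M' hM') :=
      fun h => h22 M' hM' (π.branchMap_injOn _ _ (he₂ M' hM') h)
    have ge₁ : (Dg.tree M).edgeOf (π.branchMap (β₁ M' hM')) = (Dg.tree M).edgeOf (π.branchMap (β₁' M' hM')) := by
      rw [π.edgeOf_branchMap, π.edgeOf_branchMap, he₁ M' hM']
    have ge₂ : (Dg.tree M).edgeOf (π.branchMap (β₂ M' hM')) = (Dg.tree M).edgeOf (π.branchMap (β₂' M' hM')) := by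
      rw [π.edgeOf_branchMap, π.edgeOf_branchMap, he₂ M' hM']
    have gβ₁ := π.abuts_branchMap _ _ (hβ₁ M' hM')
    have gβ₁' := π.abuts_branchMap _ _ (hβ₁' M' hM')
    have gβ₂ := π.abuts_branchMap _ _ (hβ₂ M' hM')
    have gβ₂' := π.abuts_branchMap _ _ (hβ₂' M' hM')
    -- the pushed-down middle vertex is fixed by neither subgroup (no bridge at level `M`)
    have gz₁ : ¬ ∀ k ∈ K₁, (Dg.treeAct hc M k).hom.vertexMap (π.vertexMap (z M' hM')) = π.vertexMap (z M' hM') :=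
      fun h => hnobr M hM ⟨_, _, _, _, g22, ge₂, gβ₂, gβ₂', h, gy⟩
    have gz₂ : ¬ ∀ k ∈ K₂, (Dg.treeAct hc M k).hom.vertexMap (π.vertexMap (z M' hM')) = π.vertexMap (z M' hM') :=
      fun h => hnobr M hM ⟨_, _, _, _, g11, ge₁, gβ₁, gβ₁', gx, h⟩
    -- uniqueness at level `M`
    have hzz : π.vertexMap (z M' hM') = z M hM :=
      (twoStep_middle_unique h36 K₁ K₂ M hnoM (h11 M hM) (he₁ M hM) (hβ₁ M hM) (hβ₁' M hM) (h22 M hM) (he₂ M hM)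
        (hβ₂ M hM) (hβ₂' M hM) g11 ge₁ gβ₁ gβ₁' g22 ge₂ gβ₂ gβ₂' (hx M hM) (hy M hM) (hz₁ M hM) (hz₂ M hM) gx gy
        gz₁ gz₂).symm
    rw [hzz] at gβ₁' gβ₂
    obtain ⟨hxx, hb, hb'⟩ := fixed_neighbour_unique h36 M K₁ (h11 M hM) (he₁ M hM) (hβ₁ M hM) (hβ₁' M hM) g11 ge₁
      gβ₁ gβ₁' (hx M hM) gx (hz₁ M hM)
    obtain ⟨hyy, -, -⟩ := fixed_neighbour_unique h36 M K₂ (h22 M hM).symm (he₂ M hM).symm (hβ₂' M hM) (hβ₂ M hM)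
      g22.symm ge₂.symm gβ₂' gβ₂ (hy M hM) gy (hz₂ M hM)
    exact ⟨hzz, hxx.symm, hb.symm, hb'.symm, hyy.symm⟩
  refine ⟨exists_verticial_ge_of_eventually_compatible_fixed h36 K₁ m x (fun hM hMM' => (hdesc hM hMM').2.1) hx,
    exists_verticial_ge_of_eventually_compatible_fixed h36 K₂ m y (fun hM hMM' => (hdesc hM hMM').2.2.2.2) hy, ?_⟩
  -- (I3): the eventual compatible system of edges `x_M – z_M`
  let ε : ∀ j : {j : ℕ // m ≤ j}, (Dg.tree j.1).Edge := fun j => (Dg.tree j.1).edgeOf (β₁ j.1 j.2)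
  have hε : ∀ ⦃i j : {j : ℕ // m ≤ j}⦄ (h : i.1 ≤ j.1), (Dg.treeTrans h).edgeMap (ε j) = ε i := by
    intro i j h
    change (Dg.treeTrans h).edgeMap ((Dg.tree j.1).edgeOf (β₁ j.1 j.2)) = (Dg.tree i.1).edgeOf (β₁ i.1 i.2)
    rw [← (Dg.treeTrans h).edgeOf_branchMap, (hdesc i.2 h).2.2.1]
  obtain ⟨e, L, hL, -, hstab⟩ := D₀.edge m ε hε
  refine ⟨e, L, hL, fun g hg => hstab g fun j => ?_⟩
  obtain ⟨hg₁, hg₂⟩ := Subgroup.mem_inf.mp hg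
  -- `g` fixes the path `x_j – z_j – y_j` node-wise
  have hxz : x j.1 j.2 ≠ z j.1 j.2 := fun h => hz₁ j.1 j.2 (h ▸ hx j.1 j.2)
  have hzy : z j.1 j.2 ≠ y j.1 j.2 := fun h => hz₂ j.1 j.2 (h ▸ hy j.1 j.2)
  have hxy : x j.1 j.2 ≠ y j.1 j.2 := fun h =>
    forall_not_common_fixed_of_le h36 K₁ K₂ j.2 hno (x j.1 j.2) (hx j.1 j.2) (h ▸ hy j.1 j.2)
  obtain ⟨P, hP, hPs⟩ := SemiGraph.exists_twoStep_path (h11 j.1 j.2) (he₁ j.1 j.2) (hβ₁ j.1 j.2) (hβ₁' j.1 j.2)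
    (h22 j.1 j.2) (he₂ j.1 j.2) (hβ₂ j.1 j.2) (hβ₂' j.1 j.2) hxz hzy hxy
  obtain ⟨-, hfixB⟩ := fixes_of_mem_support_path h36 j.1 g (hx j.1 j.2 g hg₁) (hy j.1 j.2 g hg₂) P hP
  have hb₁ : (Dg.treeAct hc j.1 g).hom.branchMap (β₁ j.1 j.2) = β₁ j.1 j.2 := hfixB _ (by rw [hPs]; simp)
  have hb₁' : (Dg.treeAct hc j.1 g).hom.branchMap (β₁' j.1 j.2) = β₁' j.1 j.2 := hfixB _ (by rw [hPs]; simp)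
  refine ⟨?_, fun b hb => ?_⟩
  · change (Dg.treeAct hc j.1 g).hom.edgeMap ((Dg.tree j.1).edgeOf (β₁ j.1 j.2)) = (Dg.tree j.1).edgeOf (β₁ j.1 j.2)
    rw [← (Dg.treeAct hc j.1 g).hom.edgeOf_branchMap, hb₁]
  · rcases SemiGraph.eq_or_eq_of_edgeOf_eq (h11 j.1 j.2) (he₁ j.1 j.2) hb with rfl | rfl
    · exact hb₁
    · exact hb₁'

end Anchored

end ProfiniteSemiGraph

end Literature.AnabelianGeometry.SemiGraphs

end
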